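import Summits.BirchSwinnertonDyer.BirchSwinnertonDyer.Theorems.EisensteinDepletionAtTwoStarGO2CuspEvennessCore
import HarnessLib

/-!
# Cusp-evenness, part 4: the bundle in the stub's shape, the exceptional levels, and the curve-data drop-ins

Part of the cusp-evenness package for line `kummer` of crux `StarGO2Sigma` (stmt-BirchSwinnertonDyer-27046), written by
planner bsd-rank2-p2 GEN 36 (HOME/p2/g36/lean/CuspEvenness.lean, `lean check` rc 0, 0 sorries; memo HOME/p2/g36/CUSP-EVENNESS.md;
numerics kit j312110) and landed verbatim, split into four files for the 400-line rule, by the lead star-p1 GEN 11.  The full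
mathematical overview is the module docstring of `EisensteinDepletionAtTwoStarGO2CuspEvennessParabolic.lean` (part 1).  This part: §6 `cover_clauses`, `not_exceptional_of_etale_twoTorsion`; §7 `parabolic_odd_at_exceptional` (clause (ii-a) is FALSE as typed at N = ℓ², ℓ ≡ ±3 (8)); §8 `cover_o_iii_of_ordinary`, `cover_clauses_of_curveData`.
BSD is not proved by this file; nothing here reads `r_an`.
-/


set_option linter.dupNamespace false
set_option autoImplicit false

open scoped MatrixGroups
open CongruenceSubgroup Matrix.SpecialLinearGroup

namespace Summit.BirchSwinnertonDyer.BirchSwinnertonDyer.Theorems.DepletionAtTwo.CuspEvenness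

open Literature.NumberTheory.ModularForms

/-! ### §6 The bundle in the shape of the lead's clauses, and the exceptional levels -/

section Bundle

variable {N : ℕ} {β : ℕ → ℕ}

/-- **Clauses (o), (ii-a), (iii) of `stub_gammaOneCover` (kummer v4, crux `StarGO2Sigma` 27046) for odd admissible
`(N, β)` off the exceptional levels `ℓ²`, `ℓ ≡ ±3 (mod 8)`** — elementary + tree, no modular-form input.
[cite: Stevens1982, Thm. 1.3.4, §2.4–2.5 (PDF pp. 22, 35–38)] [cite: Stevens1985, Thm. 1.3 (PDF p. 5)] -/
theorem cover_clauses (hodd : Odd N) (hadm : IsAdmissibleStabData N β)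
    (hexc : ∀ ℓ : ℕ, ℓ.Prime → N = ℓ ^ 2 → ℓ % 8 = 1 ∨ ℓ % 8 = 7) {g' : ℚ}
    (hg : ∀ x : ℚ, (∃ γ : Gamma0 N, stabEisensteinPeriod N β ((γ : SL(2, ℤ)) 0 0) ((γ : SL(2, ℤ)) 0 1)
      ((γ : SL(2, ℤ)) 1 0) ((γ : SL(2, ℤ)) 1 1) = x) ↔ ∃ n : ℤ, x = n * g') :
    g' ≠ 0 ∧
      (∀ γ : SL(2, ℤ), γ ∈ Gamma1 N → (γ : Matrix (Fin 2) (Fin 2) ℤ).trace = 2 →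
        ∃ n : ℤ, stabEisensteinPeriod N β (γ 0 0) (γ 0 1) (γ 1 0) (γ 1 1) = n * g' ∧ Even n) ∧
      (∃ b d : ℤ, 0 < d ∧ Int.gcd d (b * N) = 1 ∧ ∃ n' : ℤ,
        stabEisensteinPeriod N β (Int.gcdA d (b * N)) b (-(N : ℤ) * Int.gcdB d (b * N)) d = n' * g' ∧ Odd n') :=
  ⟨(generator_ne_zero_and_norm_ge hodd hadm hg).1, parabolic_even_gamma1 hodd hadm hexc hg,
    exists_odd_bezout_value hodd hadm hg⟩

open Literature.NumberTheory.EllipticCurves Literature.NumberTheory.EllipticCurves.Greenberg1999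
  Literature.NumberTheory.EllipticCurves.PrimeConductorTwoTorsion in
/-- **The exceptional levels are vacuous for the optimal curve.** If `W₀` (globally minimal) has conductor `N` (odd) and an
ÉTALE rational `2`-torsion abscissa `x₀` (`¬ TwoTorsionRamifiedAtTwo x₀`), then `N` is not `ℓ²` with `ℓ ≡ ±3 (mod 8)`
— the tree's `star_primeSqEtaleTwoTorsion` (Setzer–Ivorra normal form).  This is the input `hexc` of `cover_clauses` in the
binders of the stub, GIVEN `W₀.conductorNorm ℤ = N` (Carayol / the modularity clause of the parent 27021; the stub's own
binders carry only `N = W.conductorNorm ℤ`). [cite: Setzer1975, §2] [cite: Carayol1986, Thm. (A)] -/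
theorem not_exceptional_of_etale_twoTorsion (W₀ : WeierstrassCurve ℚ) [W₀.IsElliptic] [W₀.IsGloballyMinimal]
    (hodd : Odd N) (hN₀ : W₀.conductorNorm ℤ = N) {x₀ : ℚ} (hx : HasRationalTwoTorsionX W₀ x₀)
    (hnr : ¬ TwoTorsionRamifiedAtTwo x₀) :
    ∀ ℓ : ℕ, ℓ.Prime → N = ℓ ^ 2 → ℓ % 8 = 1 ∨ ℓ % 8 = 7 := by
  intro ℓ hℓ hNℓ
  have hℓodd : Odd ℓ := by
    have h : Odd (ℓ ^ 2) := hNℓ ▸ hodd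
    exact Nat.Odd.of_mul_left (by rwa [← sq])
  have h8 : ℓ % 8 = 1 ∨ ℓ % 8 = 7 ∨ (ℓ % 8 = 3 ∨ ℓ % 8 = 5) := by
    obtain ⟨k, hk⟩ := hℓodd; omega
  rcases h8 with h | h | h
  · exact Or.inl h
  · exact Or.inr h
  · exact absurd (star_primeSqEtaleTwoTorsion W₀ ℓ hℓ (hN₀.trans hNℓ) h x₀ hx) hnr

end Bundle


/-! ### §7 The exceptional levels `ℓ²`, `ℓ ≡ ±3 (mod 8)`: clause (ii-a) is FALSE there as a statement about `φ_β` -/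

section Exceptional

variable {N : ℕ} {β : ℕ → ℕ}

/-- `S(ℓ) = −(ℓ² − 1)/ℓ` at `N = ℓ²`. [cite: Stevens1982, §2.4 (PDF pp. 35–37)] -/
theorem cuspSum_primeSq {ℓ : ℕ} (hℓ : ℓ.Prime) (hN : N = ℓ ^ 2) :
    ∑ t ∈ N.divisors, stabCoeff N β t * ((t.gcd ℓ : ℕ) : ℚ) ^ 2 / t = -(((ℓ : ℚ) ^ 2 - 1) / ℓ) := by
  have hN0 : N ≠ 0 := by rw [hN]; exact pow_ne_zero _ hℓ.ne_zero
  have hℓ0 : (ℓ : ℚ) ≠ 0 := by exact_mod_cast hℓ.ne_zero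
  have hpf : N.primeFactors = {ℓ} := by rw [hN, Nat.primeFactors_prime_pow two_ne_zero hℓ]
  have hfac : N.factorization ℓ = 2 := by rw [hN, Nat.Prime.factorization_pow hℓ, Finsupp.single_eq_same]
  have g1 : (ℓ ^ 1).gcd ℓ = ℓ := by rw [pow_one, Nat.gcd_self]
  have g2 : (ℓ ^ 2).gcd ℓ = ℓ := by rw [sq, Nat.gcd_mul_left_left]
  rw [cuspSum_eq_prod hN0, hpf, Finset.prod_singleton]
  simp only [hfac, Finset.sum_range_succ, Finset.sum_range_zero, localStabCoeff, if_true,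
    show (2 : ℕ) ≠ 1 from by decide, show (1 : ℕ) ≠ 0 from one_ne_zero, show (2 : ℕ) ≠ 0 from two_ne_zero,
    if_false, pow_zero, pow_one, Nat.gcd_one_left, Nat.cast_one, Nat.cast_pow, g2, Nat.gcd_self]
  field_simp
  ring

/-- `ℓ² − 1 = 8u` with `u` odd for `ℓ ≡ ±3 (mod 8)`. [folklore] -/
theorem sq_sub_one_eq_eight_mul_odd {ℓ : ℕ} (h8 : ℓ % 8 = 3 ∨ ℓ % 8 = 5) :
    ∃ u : ℤ, (ℓ : ℤ) ^ 2 - 1 = 8 * u ∧ Odd u := by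
  have hℓ8 : (ℓ : ℤ) = 8 * (ℓ / 8 : ℕ) + (ℓ % 8 : ℕ) := by exact_mod_cast (Nat.div_add_mod ℓ 8).symm
  rcases h8 with h | h
  · refine ⟨8 * (ℓ / 8 : ℕ) ^ 2 + 6 * (ℓ / 8 : ℕ) + 1, by rw [hℓ8, h]; push_cast; ring,
      4 * (ℓ / 8 : ℕ) ^ 2 + 3 * (ℓ / 8 : ℕ), by ring⟩
  · refine ⟨8 * (ℓ / 8 : ℕ) ^ 2 + 10 * (ℓ / 8 : ℕ) + 3, by rw [hℓ8, h]; push_cast; ring,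
      4 * (ℓ / 8 : ℕ) ^ 2 + 5 * (ℓ / 8 : ℕ) + 1, by ring⟩

/-- **Clause (ii-a) of `stub_gammaOneCover` is FALSE as an Eisenstein statement at `N = ℓ²`, `ℓ ≡ ±3 (mod 8)`.**
For ANY stabilisation data `β` admissible at `N = ℓ²` and the generator `g'` of `φ_β(Γ₀(N))`, the parabolic element
`γ = σ T^ℓ σ⁻¹ = (1 − ℓ², ℓ; −ℓ³, 1 + ℓ²) ∈ Γ₁(ℓ²)` (the width-`ℓ` generator at the cusp `1/ℓ`) has `φ_β(γ) = −(ℓ² − 1)`, an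
ODD multiple of `g'` (`‖g'‖₂ = ‖ℓ² − 1‖₂ = 2⁻³`).  So at these levels the stub can only hold because its binders are
contradictory — which needs `W₀.conductorNorm ℤ = ℓ²` (then `star_primeSqEtaleTwoTorsion`), not derivable from the stub's
binders in the tree.  (Numerically: kit j312110, exceptional levels `9, 25, 121, 169, 361, 841, 1369`.)
[cite: Stevens1982, §2.4–2.5 (PDF pp. 35–38)] [cite: Setzer1975, §2] -/
theorem parabolic_odd_at_exceptional {ℓ : ℕ} (hℓ : ℓ.Prime) (h8 : ℓ % 8 = 3 ∨ ℓ % 8 = 5) (hN : N = ℓ ^ 2)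
    (hadm : IsAdmissibleStabData N β) {g' : ℚ}
    (hg : ∀ x : ℚ, (∃ γ : Gamma0 N, stabEisensteinPeriod N β ((γ : SL(2, ℤ)) 0 0) ((γ : SL(2, ℤ)) 0 1)
      ((γ : SL(2, ℤ)) 1 0) ((γ : SL(2, ℤ)) 1 1) = x) ↔ ∃ n : ℤ, x = n * g') :
    ∃ γ : SL(2, ℤ), γ ∈ Gamma1 N ∧ (γ : Matrix (Fin 2) (Fin 2) ℤ).trace = 2 ∧
      stabEisensteinPeriod N β (γ 0 0) (γ 0 1) (γ 1 0) (γ 1 1) = -((ℓ : ℚ) ^ 2 - 1) ∧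
      ∀ n : ℤ, stabEisensteinPeriod N β (γ 0 0) (γ 0 1) (γ 1 0) (γ 1 1) = n * g' → Odd n := by
  have hℓodd : Odd ℓ := by rcases h8 with h | h <;> exact Nat.odd_iff.mpr (by omega)
  have hodd : Odd N := by rw [hN]; exact hℓodd.pow
  have hN0 : N ≠ 0 := fun h ↦ by simp [h] at hodd
  let σ : SL(2, ℤ) := ⟨!![1, 0; (ℓ : ℤ), 1], by rw [Matrix.det_fin_two_of]; ring⟩
  have s00 : σ 0 0 = 1 := rfl
  have s10 : σ 1 0 = ℓ := rfl
  obtain ⟨p00, p01, p10, p11⟩ := conj_T_zpow_apply σ ℓ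
  simp only [s00, s10, mul_one, one_pow] at p00 p01 p10 p11
  have hcast : ((ℓ : ZMod N)) * (ℓ : ZMod N) = 0 := by
    rw [← Nat.cast_mul, ← sq, ← hN, ZMod.natCast_self]
  have hval : stabEisensteinPeriod N β ((σ * ModularGroup.T ^ (ℓ : ℤ) * σ⁻¹) 0 0)
      ((σ * ModularGroup.T ^ (ℓ : ℤ) * σ⁻¹) 0 1) ((σ * ModularGroup.T ^ (ℓ : ℤ) * σ⁻¹) 1 0)
      ((σ * ModularGroup.T ^ (ℓ : ℤ) * σ⁻¹) 1 1) = -((ℓ : ℚ) ^ 2 - 1) := by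
    have h := stabEisensteinPeriod_conj_T_zpow hN0 hadm σ ℓ
      (by rw [s10, hN]; push_cast; exact ⟨ℓ, by ring⟩)
    rw [h, s10]
    simp only [int_gcd_natCast_left, Int.natAbs_natCast]
    rw [cuspSum_primeSq hℓ hN]
    have hℓ0 : (ℓ : ℚ) ≠ 0 := by exact_mod_cast hℓ.ne_zero
    field_simp
    push_cast
    ring
  refine ⟨σ * ModularGroup.T ^ (ℓ : ℤ) * σ⁻¹, ?_, ?_, hval, fun n hn ↦ ?_⟩
  · rw [Gamma1_mem]
    refine ⟨?_, ?_, ?_⟩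
    · rw [p00]; push_cast; rw [hcast, sub_zero]
    · rw [p11]; push_cast; rw [hcast, add_zero]
    · rw [p10]; push_cast
      rw [sq, ← mul_assoc, hcast, zero_mul, neg_zero]
  · rw [Matrix.trace_fin_two]
    change (σ * ModularGroup.T ^ (ℓ : ℤ) * σ⁻¹) 0 0 + (σ * ModularGroup.T ^ (ℓ : ℤ) * σ⁻¹) 1 1 = 2
    rw [p00, p11]; ring
  · obtain ⟨u, hu, huodd⟩ := sq_sub_one_eq_eight_mul_odd h8
    have h1 : ((n * g' : ℚ) : ℚ_[2]) = -(8 * (u : ℚ_[2])) := by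
      rw [← hn, hval]
      have : ((ℓ : ℚ) ^ 2 - 1) = (((ℓ : ℤ) ^ 2 - 1 : ℤ) : ℚ) := by push_cast; ring
      rw [this, hu]; push_cast; ring
    have h8n : ‖(8 : ℚ_[2])‖ = 8⁻¹ := by
      rw [show (8 : ℚ_[2]) = ((2 : ℕ) : ℚ_[2]) ^ 3 by norm_num, norm_pow, Padic.norm_p]; norm_num
    have h2 := congrArg (fun x : ℚ_[2] ↦ ‖x‖) h1
    simp only [Rat.cast_mul, Rat.cast_intCast, norm_mul, norm_neg, norm_generator_eq hodd hadm hg,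
      norm_intCast_eq_one_of_odd huodd, mul_one, h8n] at h2
    have hn1 : ‖(n : ℚ_[2])‖ = 1 :=
      mul_right_cancel₀ (b := (8 : ℝ)⁻¹) (by norm_num) (h2.trans (one_mul _).symm)
    exact odd_of_norm_intCast_eq_one hn1

end Exceptional

/-! ### §8 Drop-in for line `kummer` (v5 `stub_gammaOneCover`): clauses (o), (iii) from `IsOrdinaryAt W 2` alone, and
(o), (ii-a), (iii) from the stub's curve data PLUS `W₀.conductorNorm ℤ = N` -/

section CurveData

open Literature.NumberTheory.EllipticCurves Literature.NumberTheory.EllipticCurves.Greenberg1999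

/-- **Clauses (o) and (iii) of `stub_gammaOneCover` need no `W₀` at all**: for `W` good ordinary at `2` (so `N_W` odd, tree
`not_dvd_conductorNorm_of_hasGoodReductionAtPrime`) and admissible `β` at `N_W`, the generator `g'` of `φ_β(Γ₀(N_W))` is
non-zero and some Bézout value `φ_β(γ_{b,d})/g'` is odd. [cite: Stevens1982, §2.5 (PDF p. 38)] [cite: Stevens1985, Thm. 1.3] -/
theorem cover_o_iii_of_ordinary (W : WeierstrassCurve ℚ) [W.IsElliptic] [W.IsGloballyMinimal] {N : ℕ}
    (hord : IsOrdinaryAt W 2) (hN : N = W.conductorNorm ℤ) {β : ℕ → ℕ}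
    (hadm : IsAdmissibleStabData (W.conductorNorm ℤ) β) {g' : ℚ}
    (hg : ∀ x : ℚ, (∃ γ : Gamma0 N, stabEisensteinPeriod (W.conductorNorm ℤ) β ((γ : SL(2, ℤ)) 0 0)
      ((γ : SL(2, ℤ)) 0 1) ((γ : SL(2, ℤ)) 1 0) ((γ : SL(2, ℤ)) 1 1) = x) ↔ ∃ n : ℤ, x = n * g') :
    g' ≠ 0 ∧
      (∃ b d : ℤ, 0 < d ∧ Int.gcd d (b * (W.conductorNorm ℤ : ℕ)) = 1 ∧
        ∃ n' : ℤ, stabEisensteinPeriod (W.conductorNorm ℤ) β (Int.gcdA d (b * (W.conductorNorm ℤ : ℕ))) b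
          (-((W.conductorNorm ℤ : ℕ) : ℤ) * Int.gcdB d (b * (W.conductorNorm ℤ : ℕ))) d = n' * g' ∧ Odd n') := by
  subst hN
  have hodd : Odd (W.conductorNorm ℤ) :=
    Nat.odd_iff.mpr (Nat.two_dvd_ne_zero.mp (not_dvd_conductorNorm_of_hasGoodReductionAtPrime W hord.1))
  exact ⟨(generator_ne_zero_and_norm_ge hodd hadm hg).1, exists_odd_bezout_value hodd hadm hg⟩

/-- **Clauses (o), (ii-a), (iii) of `stub_gammaOneCover` (kummer v4/v5) from the stub's curve data and ONE extra binder
`W₀.conductorNorm ℤ = N`** (in the by-name composition: the Literature named fact `IsNewformOf.level_eq_conductorNorm`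
(Carayol) at `(W₀, f)`; in the parent composition for 27021: the tree's `conductorNorm_eq_of_isNewformOf_of_modularity`).
With it the exceptional levels `ℓ²`, `ℓ ≡ ±3 (mod 8)`, are excluded by `star_primeSqEtaleTwoTorsion` and (ii-a) is
`parabolic_even_gamma1`; without it (ii-a) is false as typed at those levels (`parabolic_odd_at_exceptional`).
[cite: Stevens1982, §2.4–2.5 (PDF pp. 35–38)] [cite: Setzer1975, §2] [cite: Carayol1986, Thm. (A)] -/
theorem cover_clauses_of_curveData (W : WeierstrassCurve ℚ) [W.IsElliptic] [W.IsGloballyMinimal]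
    (W₀ : WeierstrassCurve ℚ) [W₀.IsElliptic] [W₀.IsGloballyMinimal] {N : ℕ}
    (hord : IsOrdinaryAt W 2) (hN : N = W.conductorNorm ℤ) (hN₀ : W₀.conductorNorm ℤ = N)
    {x₀ : ℚ} (hx : HasRationalTwoTorsionX W₀ x₀) (hnr : ¬ TwoTorsionRamifiedAtTwo x₀)
    {β : ℕ → ℕ} (hadm : IsAdmissibleStabData (W.conductorNorm ℤ) β) {g' : ℚ}
    (hg : ∀ x : ℚ, (∃ γ : Gamma0 N, stabEisensteinPeriod (W.conductorNorm ℤ) β ((γ : SL(2, ℤ)) 0 0)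
      ((γ : SL(2, ℤ)) 0 1) ((γ : SL(2, ℤ)) 1 0) ((γ : SL(2, ℤ)) 1 1) = x) ↔ ∃ n : ℤ, x = n * g') :
    g' ≠ 0 ∧
      (∀ γ : SL(2, ℤ), γ ∈ Gamma1 N → (γ : Matrix (Fin 2) (Fin 2) ℤ).trace = 2 →
        ∃ n : ℤ, stabEisensteinPeriod (W.conductorNorm ℤ) β (γ 0 0) (γ 0 1) (γ 1 0) (γ 1 1) = n * g' ∧ Even n) ∧
      (∃ b d : ℤ, 0 < d ∧ Int.gcd d (b * (W.conductorNorm ℤ : ℕ)) = 1 ∧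
        ∃ n' : ℤ, stabEisensteinPeriod (W.conductorNorm ℤ) β (Int.gcdA d (b * (W.conductorNorm ℤ : ℕ))) b
          (-((W.conductorNorm ℤ : ℕ) : ℤ) * Int.gcdB d (b * (W.conductorNorm ℤ : ℕ))) d = n' * g' ∧ Odd n') := by
  subst hN
  have hodd : Odd (W.conductorNorm ℤ) :=
    Nat.odd_iff.mpr (Nat.two_dvd_ne_zero.mp (not_dvd_conductorNorm_of_hasGoodReductionAtPrime W hord.1))
  exact cover_clauses hodd hadm (not_exceptional_of_etale_twoTorsion W₀ hodd hN₀ hx hnr) hg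

end CurveData


end Summit.BirchSwinnertonDyer.BirchSwinnertonDyer.Theorems.DepletionAtTwo.CuspEvenness
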